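import Mathlib

/-!
# `Balaban1983to89.B11Eq129Minimizer` — [Balaban1985Variational] (45) p. 285 and (129) p. 297: the constrained
# minimiser of a quadratic form, «H₀B = GQ*(QGQ*)^{-1}(L^{j(·)}η)^{-1}B», PROVED in abstract form (Lagrange-multiplier
# formula: it satisfies the constraint, is Δ-orthogonal to the constraint kernel, minimises, and is the unique minimiser)

statement-level skeleton of published theorems with citation tags; proofs where landed; nothing here is a claim about the Yang–Mills mass gap

CITATION HEADER (lean-in-tree rule 2026-08-18).  T. Bałaban, *The variational problem and background fields in
renormalization group method for lattice gauge theories*, Commun. Math. Phys. **102**, 277–309 (1985),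
doi:10.1007/bf01229381 [Balaban1985Variational] (cell paper B11; held `paper:balaban1985-cmp102-variational-background`,
journal page = PDF page + 276).  Render `…/1985-cmp102-variational-background-p021-x2.png` (p. 297, (127)–(129)) READ AS
AN IMAGE by this seat (lit-balaban reader/typer r08, 2026-08-20); p. 285 (45) and p. 293 from the render-verified
transcript `run/shared/lean/pub/pub-balaban/b2b-balaban-b11/transcript.md`.

THE PRINT.  p. 285 [PDF 9]: *«The operators Δ, Q and R define the operator H. Let us recall that it is an operator defined
on configurations B and giving a minimum of the quadratic form ½⟨A, ΔA⟩ under the restrictions L^jηQ_jA = B on Λ_j,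
j = 0, 1, …, k, RD*A = 0. Thus it has the following properties L^jηQ_jHB = B on Λ_j, RD*HB = 0, (45)»*.  p. 293
[PDF 17]: *«Using the identity ⟨δA′, Δ₁H₁B⟩ = 0 following from the definitions of H₁, we get the equations …»*.  p. 297
[PDF 21]: *«We decompose A′₁ = A₀ + H₀B, where H₀B is defined as a minimum of the quadratic form ½⟨A′, Δ_aA′⟩ on the
subspace L^{j(·)}ηQA′ = B. We find easily that H₀B is given by H₀B = GQ*(QGQ*)^{-1}(L^{j(·)}η)^{-1}B, (129)»* with
*«Δ_a = Δ + DRD* + Q*aQ (the constant a = 1). For the operator Δ_a^{-1} = G …»*; p. 298: *«By the definition of H₀B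
and the condition QδA′ = 0 we have ⟨δA′, Δ_aH₀B⟩ = 0.»*

WHAT IS PROVED HERE (abstract form over real inner product spaces; Mathlib only).  `E` (configurations A′), `F`
(constraint values); `Δ : E →ₗ[ℝ] E` symmetric (`⟪Δx, y⟫ = ⟪x, Δy⟫`), `G : E →ₗ[ℝ] E` with `Δ (G x) = x` (G = Δ_a^{-1}),
`Q : E →ₗ[ℝ] F` with an adjoint `Qadj` (`⟪Qx, y⟫ = ⟪x, Qadj y⟫`, the print's Q*), and an inverse `Kinv` of
`K = Q G Qadj` (`Q (G (Qadj (Kinv y))) = y`, the print's (QGQ*)^{-1}).  The candidate `hOp b = G (Qadj (Kinv b))` —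
(129) with `b = (L^{j(·)}η)^{-1}B`, i.e. the constraint `L^{j(·)}ηQA′ = B` read as `QA′ = b` — satisfies: `Q (hOp b) = b`
(`constraint_hOp`, = (45) first member); `⟪δ, Δ (hOp b)⟫ = 0` for `Qδ = 0` (`inner_delta_hOp_eq_zero`, = pp. 293/298
«⟨δA′, Δ_aH₀B⟩ = 0»); the energy splitting `⟪A, ΔA⟫ = ⟪hOp b, Δ hOp b⟫ + ⟪A − hOp b, Δ(A − hOp b)⟫` on `QA = b`
(`energy_split`); hence for `Δ ≥ 0` it MINIMISES `⟪A, ΔA⟫` on `{QA = b}` (`isMinOn_hOp`, the defining property in (45)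
and (129)), and for `Δ` positive definite on `ker Q` it is THE minimiser (`eq_hOp_of_le`).  The two-constraint operator H
of (45) (`L^jηQ_jA = B`, `RD*A = 0`) is the case `Q := (L^{j}ηQ, RD*)`, `b := (B, 0)`.  NOT modelled: the lattice
operators themselves ([5] = B9 (3.126), (3.129)), the kernel bounds (46)/(130).  Unit `lit-balaban-r08` (rows B11.Eq45,
B11.Eq129 of `HOME/lit-balaban-r08/ROWS-B11.md`).
-/

namespace Literature.MathematicalPhysics.QuantumFieldTheory.Balaban1983to89.B11Eq129Minimizer

open scoped InnerProductSpace

variable {E F : Type*} [NormedAddCommGroup E] [InnerProductSpace ℝ E] [NormedAddCommGroup F]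
  [InnerProductSpace ℝ F]

/-- The candidate minimiser of (129): `H₀ b = G Q* (QGQ*)^{-1} b` (with `b = (L^{j(·)}η)^{-1}B`).
[cite: Balaban1985Variational, (129) p.297] -/
def hOp (G : E →ₗ[ℝ] E) (Qadj : F →ₗ[ℝ] E) (Kinv : F →ₗ[ℝ] F) (b : F) : E := G (Qadj (Kinv b))

variable {Δ G : E →ₗ[ℝ] E} {Q : E →ₗ[ℝ] F} {Qadj : F →ₗ[ℝ] E} {Kinv : F →ₗ[ℝ] F}

/-- **(45), first member / the constraint in (129)**: `Q (H₀ b) = b`, since `Q G Q* (QGQ*)^{-1} b = b`.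
[cite: Balaban1985Variational, (45) p.285 + (129) p.297] -/
theorem constraint_hOp (hK : ∀ y : F, Q (G (Qadj (Kinv y))) = y) (b : F) : Q (hOp G Qadj Kinv b) = b :=
  hK b

/-- **p. 293 / p. 298: «⟨δA′, Δ_aH₀B⟩ = 0» for `QδA′ = 0`** — `Δ H₀ b = Q*(QGQ*)^{-1}b` is in the range of `Q*`, hence
Δ-orthogonal to `ker Q`. [cite: Balaban1985Variational, (129) p.297] -/
theorem inner_delta_hOp_eq_zero (hΔG : ∀ x : E, Δ (G x) = x) (hadj : ∀ (x : E) (y : F), ⟪Q x, y⟫_ℝ = ⟪x, Qadj y⟫_ℝ)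
    (b : F) {δ : E} (hδ : Q δ = 0) : ⟪δ, Δ (hOp G Qadj Kinv b)⟫_ℝ = 0 := by
  simp only [hOp, hΔG, ← hadj, hδ, inner_zero_left]

/-- The energy splitting on the constraint set: for `QA = b`, `⟪A, ΔA⟫ = ⟪H₀b, ΔH₀b⟫ + ⟪A − H₀b, Δ(A − H₀b)⟫`
(Δ symmetric). [cite: Balaban1985Variational, (129) p.297] -/
theorem energy_split (hsymm : ∀ x y : E, ⟪Δ x, y⟫_ℝ = ⟪x, Δ y⟫_ℝ) (hΔG : ∀ x : E, Δ (G x) = x)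
    (hadj : ∀ (x : E) (y : F), ⟪Q x, y⟫_ℝ = ⟪x, Qadj y⟫_ℝ) (hK : ∀ y : F, Q (G (Qadj (Kinv y))) = y)
    (b : F) {A : E} (hA : Q A = b) :
    ⟪A, Δ A⟫_ℝ = ⟪hOp G Qadj Kinv b, Δ (hOp G Qadj Kinv b)⟫_ℝ +
      ⟪A - hOp G Qadj Kinv b, Δ (A - hOp G Qadj Kinv b)⟫_ℝ := by
  set h : E := hOp G Qadj Kinv b with hh
  have hδ : Q (A - h) = 0 := by
    rw [map_sub, hA, hh, constraint_hOp hK b, sub_self]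
  have horth : ⟪A - h, Δ h⟫_ℝ = 0 := by
    rw [hh]; exact inner_delta_hOp_eq_zero hΔG hadj b (by rwa [hh] at hδ)
  have horth' : ⟪h, Δ (A - h)⟫_ℝ = 0 := by
    rw [← hsymm, real_inner_comm, horth]
  have hAeq : A = h + (A - h) := by abel
  conv_lhs => rw [hAeq]
  rw [map_add, inner_add_left, inner_add_right, inner_add_right, horth, horth']
  ring

/-- **(45) / (129): `H₀ b` MINIMISES the quadratic form `⟪A, ΔA⟫` on the constraint set `{A : QA = b}`** (Δ symmetric
and nonnegative). [cite: Balaban1985Variational, (45) p.285 + (129) p.297] -/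
theorem isMinOn_hOp (hsymm : ∀ x y : E, ⟪Δ x, y⟫_ℝ = ⟪x, Δ y⟫_ℝ) (hpsd : ∀ x : E, 0 ≤ ⟪x, Δ x⟫_ℝ)
    (hΔG : ∀ x : E, Δ (G x) = x) (hadj : ∀ (x : E) (y : F), ⟪Q x, y⟫_ℝ = ⟪x, Qadj y⟫_ℝ)
    (hK : ∀ y : F, Q (G (Qadj (Kinv y))) = y) (b : F) :
    IsMinOn (fun A : E => ⟪A, Δ A⟫_ℝ) {A : E | Q A = b} (hOp G Qadj Kinv b) := by
  intro A hA
  have := energy_split hsymm hΔG hadj hK b (A := A) hA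
  simp only [Set.mem_setOf_eq]
  linarith [hpsd (A - hOp G Qadj Kinv b)]

/-- `H₀ b` itself lies in the constraint set. [cite: Balaban1985Variational, (129) p.297] -/
theorem hOp_mem (hK : ∀ y : F, Q (G (Qadj (Kinv y))) = y) (b : F) : hOp G Qadj Kinv b ∈ {A : E | Q A = b} :=
  constraint_hOp hK b

/-- **Uniqueness («THE minimum», (45)/(129))**: if `Δ` is positive definite on `ker Q` (e.g. Δ_a = Δ + DRD* + Q*aQ > 0),
any `A` with `QA = b` and `⟪A, ΔA⟫ ≤ ⟪H₀b, ΔH₀b⟫` equals `H₀ b`. [cite: Balaban1985Variational, (45) p.285 + (129) p.297] -/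
theorem eq_hOp_of_le (hsymm : ∀ x y : E, ⟪Δ x, y⟫_ℝ = ⟪x, Δ y⟫_ℝ)
    (hpd : ∀ x : E, Q x = 0 → ⟪x, Δ x⟫_ℝ ≤ 0 → x = 0) (hΔG : ∀ x : E, Δ (G x) = x)
    (hadj : ∀ (x : E) (y : F), ⟪Q x, y⟫_ℝ = ⟪x, Qadj y⟫_ℝ) (hK : ∀ y : F, Q (G (Qadj (Kinv y))) = y) (b : F)
    {A : E} (hA : Q A = b) (hle : ⟪A, Δ A⟫_ℝ ≤ ⟪hOp G Qadj Kinv b, Δ (hOp G Qadj Kinv b)⟫_ℝ) :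
    A = hOp G Qadj Kinv b := by
  have hsplit := energy_split hsymm hΔG hadj hK b (A := A) hA
  have hδ : Q (A - hOp G Qadj Kinv b) = 0 := by
    rw [map_sub, hA, constraint_hOp hK b, sub_self]
  have hz := hpd (A - hOp G Qadj Kinv b) hδ (by linarith)
  exact sub_eq_zero.1 hz

end Literature.MathematicalPhysics.QuantumFieldTheory.Balaban1983to89.B11Eq129Minimizer
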